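import Literature.AlgebraicGeometry.Pohlmann1968.HodgeClassesProductSpanCMProductsRank
import Literature.AlgebraicGeometry.Motives.HodgeStructureOfAbelianVarietyBiproduct
import Literature.AlgebraicGeometry.Motives.MumfordTateRankOfCMFamilyUpperBound
import Literature.AlgebraicGeometry.Motives.AbelianVarietyProductIsogeny
import Literature.AlgebraicGeometry.Motives.AbelianVarietyPoincareCompleteReducibility
import Literature.AlgebraicGeometry.Motives.HodgeTensorFactsHolds
import Literature.AlgebraicGeometry.Milne1999.SpecialLefschetzGroupInvariantsCMType
import Literature.NumberTheory.ComplexMultiplication.CMTypeDictionaryGroupLevel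
import Mathlib.CategoryTheory.Limits.Shapes.CombinedProducts
import HarnessLib

/-!
# Moonen–Zarhin's criterion for CM abelian varieties, read on Mumford–Tate ranks:
# `dim MT(H¹(X × Y)) + 1 = dim MT(H¹ X) + dim MT(H¹ Y)` ⟹ Hodge classes on `X × Y` are products of those of `X`, `Y`

Family `hodge`, layer `Literature/AlgebraicGeometry/Pohlmann1968`; cell `pub-hodgecm2` (COR-CM), count-neutral own-lane
sequel of `Pohlmann1968/HodgeClassesProductSpanCMProductsRank` (the combinatorial criterion on realisations).  HONEST
FRAMING: unconditional structure theorem on Hodge classes of CM abelian varieties; not a step of the summit chain.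

THE THEOREM (`hodgeClassesProductSpan_of_isOfCMType_of_mtRank_add`).  For complex abelian varieties `X`, `Y` OF CM TYPE
(`Milne1999.IsOfCMType`, positive dimension) the Mumford–Tate groups of `H¹` are tori, `MT(X × Y) ⊆ MT(X) ×_{𝔾_m} MT(Y)`,
so `dim MT(H¹(X × Y)) + 1 ≤ dim MT(H¹ X) + dim MT(H¹ Y)` with EQUALITY iff `Hg(X × Y) = Hg(X) × Hg(Y)`.  In that case
(Moonen–Zarhin 1999, §3 (3.1), direction ⟸, for CM abelian varieties)

  `HodgeTheory.HodgeClassesProductSpan X Y`: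

every rational Hodge class on `X × Y` is a `ℂ`-combination of exterior products `pr_X^* a ∪ pr_Y^* b` of rational Hodge
classes of `X` and `Y`; hence `HC(X) ∧ HC(Y) ⟹ HC(X × Y)`.  The hypothesis is INTRINSIC (no CM structure, field or type
is mentioned): `dim MT` is the tree's `HodgeStructure.mtRank` of the rational Hodge structure `H¹(−, ℚ)`
(`BettiUniverse.hodge`).

PROOF.  `X ~ ⨁_i A_i`, `Y ~ ⨁_j A'_j` for realisations of CM types `Φ_i`, `Φ'_j` of CM fields (Milne's regrouping,
`Milne1999.exists_isIsogeny_to_biproduct_of_classes_of_isOfCMType`); `dim MT(H¹ X) = cmFamilyRank Φ` (Deligne I Ex.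
3.7 (c) on the variety: `mtRank_hodge_one_eq_of_isIsogenous_biproduct`, `mtRank_pi_bettiHodge_eq_cmFamilyRank`);
`X × Y ~ (⨁ A_i) × (⨁ A'_j) ≅ ⨁_{k ∈ I ⊔ J} A''_k` (Mathlib's `Fan.combPairIsLimit`), the glued family over `I ⊔ J`
realising the glued type, whose rank is the `typeRank` of `Σ ⊔ Σ'` (`typeRank_preimage_eq` along
`⊔_{I ⊔ J} Hom = (⊔_I Hom) ⊔ (⊔_J Hom)`) — `mtRank_hodge_one_eq_typeRank_sum_of_isIsogenous_prod`; then
`hodgeClassesProductSpan_of_isIsogenous_biproduct_of_typeRank_add`.  Theorems only; no definition, no named fact; axioms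
`propext`, `Classical.choice`, `Quot.sound`.

## References
* [MoonenZarhin1999LowDim] B. Moonen, Yu. Zarhin, Math. Ann. 315 (1999) 711–733, §3 (3.1).
* [Deligne1982HodgeCycles] P. Deligne, *Hodge cycles on abelian varieties*, LNM 900 (1982), I Ex. 3.7 (c).
* [Gordon1999HodgeAVSurvey] B. B. Gordon, *A survey of the Hodge conjecture for abelian varieties*, §3, 7.5–7.7, 9.1.
* [Milne1999LefschetzClasses] J. S. Milne, Compositio Math. 117 (1999), §1 Prop. 1.1.
-/

noncomputable section

open CategoryTheory CategoryTheory.Limits NumberField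

namespace Literature.AlgebraicGeometry.Pohlmann1968

open Module
open Literature.AlgebraicGeometry.Motives
open Literature.AlgebraicGeometry.Motives.AbelianVariety
open Literature.AlgebraicGeometry.HodgeTheory
open Literature.AlgebraicGeometry.ComplexMultiplication (IsCMTypeRealisation)
open Literature.AlgebraicGeometry.Milne1999 (IsOfCMType)
open Literature.NumberTheory.ComplexMultiplication

/-! ### §1 The Mumford–Tate rank of `H¹(X × Y)` for CM products is the rank of the glued type -/

section Glue

variable {a b : ℕ} {K : Fin a → Type} {K' : Fin b → Type}
  [∀ i, Field (K i)] [∀ i, NumberField (K i)] [∀ j, Field (K' j)] [∀ j, NumberField (K' j)]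
  {Φ : ∀ i, CMType (K i)} {Φ' : ∀ j, CMType (K' j)}
  {A : Fin a → AbelianVariety ℂ} {A' : Fin b → AbelianVariety ℂ}
  {ι : ∀ i, 𝓞 (K i) →+* End (A i)} {ι' : ∀ j, 𝓞 (K' j) →+* End (A' j)}
  {θ : ∀ i, K i →+* Module.End ℂ (complexBetti (A i).X 1)}
  {θ' : ∀ j, K' j →+* Module.End ℂ (complexBetti (A' j).X 1)}

/-- `X × Y` is isogenous to the biproduct of the glued family when `X ~ ⨁ A_i` and `Y ~ ⨁ A'_j` (products of
isogenies are isogenies; `(⨁ A_i) × (⨁ A'_j) ≅ ⨁ (A ⊔ A')` by Mathlib's `Fan.combPairIsLimit`).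
[cite: Milne1986AbelianVarieties, §12 p. 122] -/
theorem isIsogenous_prod_biproduct_sum {X Y : AbelianVariety ℂ} (hXi : IsIsogenous X (⨁ A))
    (hYi : IsIsogenous Y (⨁ A')) :
    IsIsogenous (X.prod Y) (⨁ (Sum.elim A A' : Fin a ⊕ Fin b → AbelianVariety ℂ)) := by
  obtain ⟨g, hg⟩ := hXi.prod hYi
  -- `(⨁ A) × (⨁ A') ≅ ⨁ (A ⊔ A')`: a binary product of finite biproducts is the biproduct over the disjoint union
  let e : (⨁ A).prod (⨁ A') ≅ ⨁ (Sum.elim A A' : Fin a ⊕ Fin b → AbelianVariety ℂ) :=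
    (Fan.combPairIsLimit (c₁ := (biproduct.bicone A).toCone) (c₂ := (biproduct.bicone A').toCone)
        (bc := prodBinaryFan (⨁ A) (⨁ A')) (biproduct.isLimit A) (biproduct.isLimit A')
        (prodBinaryFanIsLimit (⨁ A) (⨁ A'))).conePointUniqueUpToIso
      (biproduct.isLimit (Sum.elim A A' : Fin a ⊕ Fin b → AbelianVariety ℂ))
  exact ⟨g ≫ e.hom, isIsogeny_comp hg (isIsogeny_hom_of_iso e)⟩

variable [HodgeTensorFacts.{0, 0}]

/-- **`dim MT(H¹(Z)) = rank(Σ ⊔ Σ')` for every `Z` isogenous to `(⨁_i A_i) × (⨁_j A'_j)`**, `A_i`, `A'_j` realisations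
of CM types `Φ_i` of `K_i`, `Φ'_j` of `K'_j` read on `H¹`: Deligne's Ex. 3.7 (c) (`dim MT = rank of the Galois module
generated by the type`) for the CM algebra `∏ K_i × ∏ K'_j` of `X × Y`, on the variety (isogeny invariance, Künneth in
degree one, the glued family over `I ⊔ J`). [cite: Deligne1982HodgeCycles, I Ex. 3.7 (c)]
[cite: Gordon1999HodgeAVSurvey, 9.1] -/
theorem mtRank_hodge_one_eq_typeRank_sum_of_isIsogenous_prod
    (hA : ∀ i, IsCMTypeRealisation (Φ i) (A i) (ι i) (θ i))
    (hA' : ∀ j, IsCMTypeRealisation (Φ' j) (A' j) (ι' j) (θ' j))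
    {Z : AbelianVariety ℂ} {k : ℕ} (hZ : IsSmoothProjective k Z.X) (hZB : IsIsogenous Z ((⨁ A).prod (⨁ A'))) :
    haveI := BettiUniverse.finite hZ 1
    (BettiUniverse.hodge exists_isReal_hodgeModel_holds hZ 1).mtRank =
      typeRank (ℂ ≃+* ℂ) {z : (Σ i, (K i →+* ℂ)) ⊕ (Σ j, (K' j →+* ℂ)) |
        Sum.elim (· ∈ CMAlgebra.familyType Φ) (· ∈ CMAlgebra.familyType Φ') z} := by
  classical
  haveI := BettiUniverse.finite hZ 1
  -- the glued family over `Fin a ⊕ Fin b`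
  letI instF : ∀ k, Field (Sum.elim K K' k) := fun k =>
    Sum.rec (motive := fun k => Field (Sum.elim K K' k)) (fun i => inferInstanceAs (Field (K i)))
      (fun j => inferInstanceAs (Field (K' j))) k
  letI instN : ∀ k, NumberField (Sum.elim K K' k) := fun k =>
    Sum.rec (motive := fun k => NumberField (Sum.elim K K' k)) (fun i => inferInstanceAs (NumberField (K i)))
      (fun j => inferInstanceAs (NumberField (K' j))) k
  let ΦJ : ∀ k, CMType (Sum.elim K K' k) := fun k => Sum.rec (motive := fun k => CMType (Sum.elim K K' k)) Φ Φ' k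
  let AJ : Fin a ⊕ Fin b → AbelianVariety ℂ := Sum.elim A A'
  let ιJ : ∀ k, 𝓞 (Sum.elim K K' k) →+* End (AJ k) := fun k =>
    Sum.rec (motive := fun k => 𝓞 (Sum.elim K K' k) →+* End (AJ k)) ι ι' k
  let θJ : ∀ k, Sum.elim K K' k →+* Module.End ℂ (complexBetti (AJ k).X 1) := fun k =>
    Sum.rec (motive := fun k => Sum.elim K K' k →+* Module.End ℂ (complexBetti (AJ k).X 1)) θ θ' k
  have hAJ : ∀ k, IsCMTypeRealisation (ΦJ k) (AJ k) (ιJ k) (θJ k) := fun k => by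
    rcases k with i | j
    · exact hA i
    · exact hA' j
  have hZJ : IsIsogenous Z (⨁ AJ) := hZB.trans (isIsogenous_prod_biproduct_sum (IsIsogenous.refl _) (IsIsogenous.refl _))
  rw [mtRank_hodge_one_eq_of_isIsogenous_biproduct (A := AJ) (fun k => (hAJ k).1) exists_isReal_hodgeModel_holds
      hodgePQ_independent_of_hodgeModel_holds hZ hZJ,
    HodgeStructure.mtRank_pi_bettiHodge_eq_cmFamilyRank hAJ exists_isReal_hodgeModel_holds
      hodgePQ_independent_of_hodgeModel_holds]
  -- `cmFamilyRank ΦJ = typeRank (Σ ⊔ Σ')`: the equivariant bijection `(⊔_I Hom) ⊔ (⊔_J Hom) ≃ ⊔_{I ⊔ J} Hom`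
  let e : ((Σ i, (K i →+* ℂ)) ⊕ (Σ j, (K' j →+* ℂ))) ≃ (Σ k : Fin a ⊕ Fin b, (Sum.elim K K' k →+* ℂ)) :=
    { toFun := Sum.elim (fun x => ⟨Sum.inl x.1, x.2⟩) (fun y => ⟨Sum.inr y.1, y.2⟩)
      invFun := fun z => Sum.rec
        (motive := fun k => (Sum.elim K K' k →+* ℂ) → (Σ i, (K i →+* ℂ)) ⊕ (Σ j, (K' j →+* ℂ)))
        (fun i s => Sum.inl ⟨i, s⟩) (fun j t => Sum.inr ⟨j, t⟩) z.1 z.2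
      left_inv := fun z => by rcases z with ⟨i, s⟩ | ⟨j, t⟩ <;> rfl
      right_inv := fun z => by
        obtain ⟨k, s⟩ := z
        rcases k with i | j <;> rfl }
  have hpre : e ⁻¹' CMAlgebra.familyType ΦJ =
      {z : (Σ i, (K i →+* ℂ)) ⊕ (Σ j, (K' j →+* ℂ)) |
        Sum.elim (· ∈ CMAlgebra.familyType Φ) (· ∈ CMAlgebra.familyType Φ') z} := by
    ext z
    rcases z with ⟨i, s⟩ | ⟨j, t⟩ <;> rfl
  rw [← hpre, CMAlgebra.cmFamilyRank]
  refine (typeRank_preimage_eq (G := ℂ ≃+* ℂ) (G' := ℂ ≃+* ℂ) (CMAlgebra.familyType ΦJ) e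
    (fun τ => ⟨τ, fun z => ?_⟩) (fun τ => ⟨τ, fun z => ?_⟩)).symm <;>
  · rcases z with ⟨i, s⟩ | ⟨j, t⟩ <;> rfl

/-- **`dim MT(H¹(X)) = cmFamilyRank Φ` for `X ~ ⨁_i A_i`** (Deligne I Ex. 3.7 (c) on the variety; the `cls = id` case
of the tree's `mtRank_hodge_one_eq_cmFamilyRank_of_isIsogenous_biproduct`). [cite: Deligne1982HodgeCycles, I Ex. 3.7 (c)]
[cite: Gordon1999HodgeAVSurvey, 9.1] -/
theorem mtRank_hodge_one_eq_cmFamilyRank_of_isIsogenous_biproduct_fin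
    (hA : ∀ i, IsCMTypeRealisation (Φ i) (A i) (ι i) (θ i)) {X : AbelianVariety ℂ} {k : ℕ}
    (hX : IsSmoothProjective k X.X) (hXB : IsIsogenous X (⨁ A)) :
    haveI := BettiUniverse.finite hX 1
    (BettiUniverse.hodge exists_isReal_hodgeModel_holds hX 1).mtRank = CMAlgebra.cmFamilyRank Φ := by
  classical
  haveI := BettiUniverse.finite hX 1
  rw [mtRank_hodge_one_eq_of_isIsogenous_biproduct (A := A) (fun i => (hA i).1) exists_isReal_hodgeModel_holds
      hodgePQ_independent_of_hodgeModel_holds hX hXB,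
    HodgeStructure.mtRank_pi_bettiHodge_eq_cmFamilyRank hA exists_isReal_hodgeModel_holds
      hodgePQ_independent_of_hodgeModel_holds]

/-- **`dim MT(H¹(X × Y)) + 1 ≤ dim MT(H¹ X) + dim MT(H¹ Y)` for CM products** (`Hg(X × Y) ⊆ Hg(X) × Hg(Y)`; the
rank-additive case is the hypothesis of the product-span theorem below). [cite: Gordon1999HodgeAVSurvey, 7.7] -/
theorem mtRank_hodge_one_prod_add_one_le [∀ i, IsCMField (K i)] [∀ j, IsCMField (K' j)] [NeZero a] [NeZero b]
    (hA : ∀ i, IsCMTypeRealisation (Φ i) (A i) (ι i) (θ i))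
    (hA' : ∀ j, IsCMTypeRealisation (Φ' j) (A' j) (ι' j) (θ' j))
    {X Y : AbelianVariety ℂ} {kX kY kXY : ℕ} (hX : IsSmoothProjective kX X.X) (hY : IsSmoothProjective kY Y.X)
    (hXY : IsSmoothProjective kXY (X.prod Y).X) (hXi : IsIsogenous X (⨁ A)) (hYi : IsIsogenous Y (⨁ A')) :
    haveI := BettiUniverse.finite hX 1
    haveI := BettiUniverse.finite hY 1
    haveI := BettiUniverse.finite hXY 1
    (BettiUniverse.hodge exists_isReal_hodgeModel_holds hXY 1).mtRank + 1 ≤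
      (BettiUniverse.hodge exists_isReal_hodgeModel_holds hX 1).mtRank +
        (BettiUniverse.hodge exists_isReal_hodgeModel_holds hY 1).mtRank := by
  rw [mtRank_hodge_one_eq_typeRank_sum_of_isIsogenous_prod hA hA' hXY (hXi.prod hYi),
    mtRank_hodge_one_eq_cmFamilyRank_of_isIsogenous_biproduct_fin hA hX hXi,
    mtRank_hodge_one_eq_cmFamilyRank_of_isIsogenous_biproduct_fin hA' hY hYi]
  exact typeRank_sum_add_one_le_cmFamilyRank Φ Φ'

/-- **Moonen–Zarhin (3.1) for CM products, on Mumford–Tate ranks**: for `X ~ ⨁ A_i`, `Y ~ ⨁ A'_j` (realisations of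
CM types of CM fields), `dim MT(H¹(X × Y)) + 1 = dim MT(H¹ X) + dim MT(H¹ Y)` ⟹ `HodgeClassesProductSpan X Y`.
[cite: MoonenZarhin1999LowDim, §3 (3.1)] [cite: Deligne1982HodgeCycles, I Ex. 3.7 (c)] -/
theorem hodgeClassesProductSpan_of_isIsogenous_biproduct_of_mtRank_add [∀ i, IsCMField (K i)]
    [∀ j, IsCMField (K' j)] [NeZero a] [NeZero b]
    (hA : ∀ i, IsCMTypeRealisation (Φ i) (A i) (ι i) (θ i))
    (hA' : ∀ j, IsCMTypeRealisation (Φ' j) (A' j) (ι' j) (θ' j))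
    {X Y : AbelianVariety ℂ} {kX kY kXY : ℕ} (hX : IsSmoothProjective kX X.X) (hY : IsSmoothProjective kY Y.X)
    (hXY : IsSmoothProjective kXY (X.prod Y).X) (hXi : IsIsogenous X (⨁ A)) (hYi : IsIsogenous Y (⨁ A'))
    (hmt : haveI := BettiUniverse.finite hX 1
      haveI := BettiUniverse.finite hY 1
      haveI := BettiUniverse.finite hXY 1
      (BettiUniverse.hodge exists_isReal_hodgeModel_holds hXY 1).mtRank + 1 =
        (BettiUniverse.hodge exists_isReal_hodgeModel_holds hX 1).mtRank +
          (BettiUniverse.hodge exists_isReal_hodgeModel_holds hY 1).mtRank) :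
    HodgeClassesProductSpan X Y := by
  rw [mtRank_hodge_one_eq_typeRank_sum_of_isIsogenous_prod hA hA' hXY (hXi.prod hYi),
    mtRank_hodge_one_eq_cmFamilyRank_of_isIsogenous_biproduct_fin hA hX hXi,
    mtRank_hodge_one_eq_cmFamilyRank_of_isIsogenous_biproduct_fin hA' hY hYi] at hmt
  exact hodgeClassesProductSpan_of_isIsogenous_biproduct_of_typeRank_add hA hA' hmt hXi hYi

end Glue

/-! ### §2 The intrinsic statement for abelian varieties of CM type -/

section Intrinsic

variable [HodgeTensorFacts.{0, 0}]

/-- **Moonen–Zarhin (3.1) ⟸ for abelian varieties of CM type, read on Mumford–Tate ranks.**  Let `X`, `Y` be complex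
abelian varieties of CM type (`IsOfCMType`) of positive dimension.  If `dim MT(H¹(X × Y)) + 1 = dim MT(H¹ X) +
dim MT(H¹ Y)` — equivalently `dim Hg(X × Y) = dim Hg(X) + dim Hg(Y)`, i.e. `Hg(X × Y) = Hg(X) × Hg(Y)` (tori) — then
every rational Hodge class on `X × Y` is a `ℂ`-combination of exterior products `pr_X^* a ∪ pr_Y^* b` of rational Hodge
classes of `X` and `Y`: `HodgeTheory.HodgeClassesProductSpan X Y`.  (The Mumford–Tate ranks are `mtRank` of the
rational Hodge structures `H¹(−(ℂ), ℚ)`; the smooth-projective witnesses may be `AbelianVariety.isSmoothProjective_holds`.)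
[cite: MoonenZarhin1999LowDim, §3 (3.1)] [cite: Deligne1982HodgeCycles, I Ex. 3.7 (c)]
[cite: Milne1999LefschetzClasses, §1 Prop. 1.1 (p. 643)] -/
theorem hodgeClassesProductSpan_of_isOfCMType_of_mtRank_add {X Y : AbelianVariety ℂ} (hX0 : 0 < X.dim)
    (hY0 : 0 < Y.dim) (hcmX : IsOfCMType X) (hcmY : IsOfCMType Y) {kX kY kXY : ℕ}
    (hX : IsSmoothProjective kX X.X) (hY : IsSmoothProjective kY Y.X) (hXY : IsSmoothProjective kXY (X.prod Y).X)
    (hmt : haveI := BettiUniverse.finite hX 1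
      haveI := BettiUniverse.finite hY 1
      haveI := BettiUniverse.finite hXY 1
      (BettiUniverse.hodge exists_isReal_hodgeModel_holds hXY 1).mtRank + 1 =
        (BettiUniverse.hodge exists_isReal_hodgeModel_holds hX 1).mtRank +
          (BettiUniverse.hodge exists_isReal_hodgeModel_holds hY 1).mtRank) :
    HodgeClassesProductSpan X Y := by
  classical
  obtain ⟨C, _, K, _, _, _, Φ, A, ι, θ, a, cls, f, hA, -, -, hf⟩ :=
    Milne1999.exists_isIsogeny_to_biproduct_of_classes_of_isOfCMType hX0 hcmX
  obtain ⟨C', _, K', _, _, _, Φ', A', ι', θ', b, cls', f', hA', -, -, hf'⟩ :=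
    Milne1999.exists_isIsogeny_to_biproduct_of_classes_of_isOfCMType hY0 hcmY
  exact hodgeClassesProductSpan_of_isIsogenous_biproduct_of_mtRank_add (K := fun i => K (cls i))
    (K' := fun j => K' (cls' j)) (Φ := fun i => Φ (cls i)) (Φ' := fun j => Φ' (cls' j))
    (fun i => hA (cls i)) (fun j => hA' (cls' j)) hX hY hXY ⟨f, hf⟩ ⟨f', hf'⟩ hmt

/-- **The inequality `dim MT(H¹(X × Y)) + 1 ≤ dim MT(H¹ X) + dim MT(H¹ Y)`** for complex abelian varieties `X`, `Y` of CM
type and positive dimension (`Hg(X × Y) ⊆ Hg(X) × Hg(Y)`). [cite: Gordon1999HodgeAVSurvey, 7.7]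
[cite: Milne1999LefschetzClasses, §1 Prop. 1.1 (p. 643)] -/
theorem mtRank_hodge_one_prod_add_one_le_of_isOfCMType {X Y : AbelianVariety ℂ} (hX0 : 0 < X.dim)
    (hY0 : 0 < Y.dim) (hcmX : IsOfCMType X) (hcmY : IsOfCMType Y) {kX kY kXY : ℕ}
    (hX : IsSmoothProjective kX X.X) (hY : IsSmoothProjective kY Y.X) (hXY : IsSmoothProjective kXY (X.prod Y).X) :
    haveI := BettiUniverse.finite hX 1
    haveI := BettiUniverse.finite hY 1
    haveI := BettiUniverse.finite hXY 1
    (BettiUniverse.hodge exists_isReal_hodgeModel_holds hXY 1).mtRank + 1 ≤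
      (BettiUniverse.hodge exists_isReal_hodgeModel_holds hX 1).mtRank +
        (BettiUniverse.hodge exists_isReal_hodgeModel_holds hY 1).mtRank := by
  classical
  obtain ⟨C, _, K, _, _, _, Φ, A, ι, θ, a, cls, f, hA, -, -, hf⟩ :=
    Milne1999.exists_isIsogeny_to_biproduct_of_classes_of_isOfCMType hX0 hcmX
  obtain ⟨C', _, K', _, _, _, Φ', A', ι', θ', b, cls', f', hA', -, -, hf'⟩ :=
    Milne1999.exists_isIsogeny_to_biproduct_of_classes_of_isOfCMType hY0 hcmY
  exact mtRank_hodge_one_prod_add_one_le (K := fun i => K (cls i)) (K' := fun j => K' (cls' j))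
    (Φ := fun i => Φ (cls i)) (Φ' := fun j => Φ' (cls' j)) (fun i => hA (cls i)) (fun j => hA' (cls' j))
    hX hY hXY ⟨f, hf⟩ ⟨f', hf'⟩

/-- **`HC(X) ∧ HC(Y) ⟹ HC(X × Y)` for complex abelian varieties `X`, `Y` of CM type with `Hg(X × Y) = Hg(X) × Hg(Y)`**
(Mumford–Tate rank additivity), by `hodgeConjectureFor_prod_of_productSpan`. [cite: MoonenZarhin1999LowDim, §3 (3.1)]
[cite: VoisinHodgeII2003, proof of Prop. 9.20 (first display)] -/
theorem hodgeConjectureFor_prod_of_isOfCMType_of_mtRank_add {X Y : AbelianVariety ℂ} (hX0 : 0 < X.dim)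
    (hY0 : 0 < Y.dim) (hcmX : IsOfCMType X) (hcmY : IsOfCMType Y) {kX kY kXY : ℕ}
    (hX : IsSmoothProjective kX X.X) (hY : IsSmoothProjective kY Y.X) (hXY : IsSmoothProjective kXY (X.prod Y).X)
    (hmt : haveI := BettiUniverse.finite hX 1
      haveI := BettiUniverse.finite hY 1
      haveI := BettiUniverse.finite hXY 1
      (BettiUniverse.hodge exists_isReal_hodgeModel_holds hXY 1).mtRank + 1 =
        (BettiUniverse.hodge exists_isReal_hodgeModel_holds hX 1).mtRank +
          (BettiUniverse.hodge exists_isReal_hodgeModel_holds hY 1).mtRank)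
    (hHX : HodgeConjectureFor X.dim X.X) (hHY : HodgeConjectureFor Y.dim Y.X) :
    HodgeConjectureFor (X.prod Y).dim (X.prod Y).X :=
  hodgeConjectureFor_prod_of_productSpan X Y
    (hodgeClassesProductSpan_of_isOfCMType_of_mtRank_add hX0 hY0 hcmX hcmY hX hY hXY hmt) hHX hHY

end Intrinsic

/-! ### §3 Instance-free forms (`HodgeTensorFacts` and the smooth-projective witnesses discharged) -/

section Holds

/-- **Moonen–Zarhin (3.1) ⟸ for CM abelian varieties, closed form**: `X`, `Y` of CM type and positive dimension with
`dim MT(H¹(X × Y)) + 1 = dim MT(H¹ X) + dim MT(H¹ Y)` (all data of the tree: `hodgeTensorFacts_holds`,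
`isSmoothProjective_holds`) ⟹ `HodgeClassesProductSpan X Y`. [cite: MoonenZarhin1999LowDim, §3 (3.1)] -/
theorem hodgeClassesProductSpan_of_isOfCMType_of_mtRank_add' {X Y : AbelianVariety ℂ} (hX0 : 0 < X.dim)
    (hY0 : 0 < Y.dim) (hcmX : IsOfCMType X) (hcmY : IsOfCMType Y)
    (hmt :
      @HodgeStructure.mtRank _ _ _ hodgeTensorFacts_holds.{0, 0}
          (BettiUniverse.finite (AbelianVariety.isSmoothProjective_holds (A := X.prod Y)) 1) _
          (BettiUniverse.hodge exists_isReal_hodgeModel_holds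
            (AbelianVariety.isSmoothProjective_holds (A := X.prod Y)) 1) + 1 =
        @HodgeStructure.mtRank _ _ _ hodgeTensorFacts_holds.{0, 0}
            (BettiUniverse.finite (AbelianVariety.isSmoothProjective_holds (A := X)) 1) _
            (BettiUniverse.hodge exists_isReal_hodgeModel_holds (AbelianVariety.isSmoothProjective_holds (A := X)) 1) +
          @HodgeStructure.mtRank _ _ _ hodgeTensorFacts_holds.{0, 0}
            (BettiUniverse.finite (AbelianVariety.isSmoothProjective_holds (A := Y)) 1) _
            (BettiUniverse.hodge exists_isReal_hodgeModel_holds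
              (AbelianVariety.isSmoothProjective_holds (A := Y)) 1)) :
    HodgeClassesProductSpan X Y := by
  haveI : HodgeTensorFacts.{0, 0} := hodgeTensorFacts_holds.{0, 0}
  exact hodgeClassesProductSpan_of_isOfCMType_of_mtRank_add hX0 hY0 hcmX hcmY
    AbelianVariety.isSmoothProjective_holds AbelianVariety.isSmoothProjective_holds
    AbelianVariety.isSmoothProjective_holds hmt

end Holds

end Literature.AlgebraicGeometry.Pohlmann1968

end
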